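import Mathlib
import Literature.Geometry.Symplectic.JHolomorphicSheetChartInverse
import Literature.Geometry.Symplectic.JHolomorphicSheetDbarLocal
import Literature.Analysis.Complex.SimilarityPrincipleLocal
import HarnessLib

/-!
# Two `J`-holomorphic sheets through a point: nested images, or an isolated intersection of positive index

The local dichotomy behind positivity of intersections of `J`-holomorphic curves in dimension
four (McDuff (1991), Thm 1.1 and §5 cases (i)–(ii); McDuff–Salamon (2012), §2.4 and App. E;
Wendl (2020), App. B, Prop. B.37/B.39 in the case where one branch is immersed). Let `F` be a
real normed space of dimension `4` with a smooth operator field `J`, let `b : ℂ → F` be smooth,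
`J`-holomorphic near `z₁` (`db (iα) = J (b z) (db α)`, `J (b z)² = -1` there) and immersed at `z₁`,
and let `v : ℂ → F` be smooth and `J`-holomorphic near `z₂` with `v z₂ = b z₁`. Read `v` in the
sheet chart `e = sheetChart J b ν₀` of `b` (`Literature/Geometry/Symplectic/JHolomorphicSheetChart*.lean`):
`e.symm (v ζ) = (a ζ, c ζ)`. Then (`sheet_dichotomy`) EITHER the normal coordinate `c` vanishes
identically near `z₂` — i.e. `v ζ = b (a ζ)` near `z₂`, the image germ of `v` at `z₂` lies in the
sheet `b` (`eq_sheet_of_snd_symm_eq_zero`) — OR `z₂` is an isolated zero of `c` and the winding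
number of `c` along every small circle about `z₂` is strictly positive (the local intersection
index of `v` with the sheet `b` at `v z₂ = b z₁` is positive).

Proof: the sheet chart is `J`-complex-linear along the axis near `z₁` (`sheetChartDeriv_hol`) and
a local diffeomorphism with smooth inverse and `dE` bounded below (`exists_sheetChart_localInverse`);
the scalar reduction `sheetDbarInequality_local` gives `‖∂̄ c‖ ≤ M ‖c‖` on a closed disc about `z₂`,
and the local similarity principle `similarity_local_dichotomy` concludes.

## References

* D. McDuff, *The local behaviour of holomorphic curves in almost complex 4-manifolds*,
  J. Differential Geom. 34 (1991), Thm 1.1, Lemma 2.5, §5 (5.1). [McDuff1991LocalBehaviour]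
* D. McDuff, D. Salamon, *J-holomorphic curves and symplectic topology*, 2nd ed. (2012), §2.4,
  App. E. [McDuffSalamon2012]
* C. Wendl, *Lectures on Contact 3-Manifolds, Holomorphic Curves and Intersection Theory* (2020),
  App. B, Prop. B.37, B.39. [Wendl2020]
-/

noncomputable section

open scoped ContDiff Topology
open Set Function Metric Filter
open Literature.Topology.PlaneTopology Literature.Analysis.Complex

namespace Literature.Geometry.Symplectic

variable {F : Type*} [NormedAddCommGroup F] [NormedSpace ℝ F]

/-- In a sheet chart `e = sheetChart J b ν₀`, a point of the target with vanishing normal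
coordinate lies on the sheet: `(e.symm y).2 = 0 → y = b (e.symm y).1`. [folklore] -/
theorem eq_sheet_of_snd_symm_eq_zero {J : F → F →L[ℝ] F} {b : ℂ → F} {ν₀ : F}
    {e : OpenPartialHomeomorph (ℂ × ℂ) F} (he : ⇑e = sheetChart J b ν₀) {y : F}
    (hy : y ∈ e.target) (h2 : (e.symm y).2 = 0) : y = b (e.symm y).1 := by
  have h := e.right_inv hy
  rw [he] at h
  conv_lhs => rw [← h]
  have hp : e.symm y = ((e.symm y).1, 0) := Prod.ext rfl h2
  rw [hp, sheetChart_mk_zero]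

/-- **Two `J`-holomorphic sheets through a point, one immersed: nested, or isolated of positive
index.** Let `dim F = 4`, `J` smooth; `b` smooth, `J`-holomorphic on `B(z₁, R₁)` with `J² = -1`
along it, immersed at `z₁`; `v` smooth, `J`-holomorphic on `B(z₂, R₂)`, `v z₂ = b z₁`. Then in a
sheet chart `e = sheetChart J b ν₀` (local diffeomorphism at `(z₁,0)` with smooth inverse, `v ζ` in
its target for `ζ ∈ B(z₂, ρ₀)`), writing `c ζ = (e.symm (v ζ)).2` for the normal coordinate:
either `c = 0` near `z₂`, or for some `0 < ε < ρ₀`, `c ≠ 0` on `0 < ‖ζ - z₂‖ ≤ ε` and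
`0 < wind (c ∘ circleLoop z₂ ε')` for all `0 < ε' ≤ ε`.
[cite: McDuff1991LocalBehaviour, Thm 1.1 and §5 (5.1) cases (i)–(ii)] -/
theorem sheet_dichotomy [FiniteDimensional ℝ F] (h4 : Module.finrank ℝ F = 4)
    {J : F → F →L[ℝ] F} (hJ : ContDiff ℝ ∞ J)
    {b v : ℂ → F} {z₁ z₂ : ℂ} {R₁ R₂ : ℝ} (hR₁ : 0 < R₁) (hR₂ : 0 < R₂)
    (hb : ContDiff ℝ ∞ b)
    (hbJ : ∀ z ∈ ball z₁ R₁, ∀ α : ℂ, fderiv ℝ b z (Complex.I * α) = J (b z) (fderiv ℝ b z α))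
    (hJ2 : ∀ z ∈ ball z₁ R₁, ∀ w : F, J (b z) (J (b z) w) = -w)
    (hinj : Injective (fderiv ℝ b z₁))
    (hv : ContDiff ℝ ∞ v)
    (hvJ : ∀ z ∈ ball z₂ R₂, ∀ α : ℂ, fderiv ℝ v z (Complex.I * α) = J (v z) (fderiv ℝ v z α))
    (hx : v z₂ = b z₁) :
    ∃ (ν₀ : F) (e : OpenPartialHomeomorph (ℂ × ℂ) F) (ρ₀ : ℝ),
      ⇑e = sheetChart J b ν₀ ∧ ((z₁, 0) : ℂ × ℂ) ∈ e.source ∧ ContDiffOn ℝ ∞ e.symm e.target ∧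
      0 < ρ₀ ∧ (∀ ζ ∈ ball z₂ ρ₀, v ζ ∈ e.target) ∧
      ((∀ᶠ ζ in 𝓝 z₂, (e.symm (v ζ)).2 = 0) ∨
        ∃ ε : ℝ, 0 < ε ∧ ε < ρ₀ ∧
          (∀ ζ : ℂ, 0 < ‖ζ - z₂‖ → ‖ζ - z₂‖ ≤ ε → (e.symm (v ζ)).2 ≠ 0) ∧
          ∀ ε' : ℝ, 0 < ε' → ε' ≤ ε →
            0 < wind (fun t => (e.symm (v (circleLoop z₂ ε' t))).2)) := by
  -- the sheet chart and its local inverse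
  obtain ⟨ν₀, e, hcoe, hsrc, hsymm, r, B, hr, hball, hB⟩ :=
    exists_sheetChart_localInverse h4 hJ hb hinj (hbJ z₁ (mem_ball_self hR₁))
      (hJ2 z₁ (mem_ball_self hR₁))
  have hE : ContDiff ℝ ∞ (sheetChart J b ν₀) := contDiff_sheetChart hJ hb ν₀
  -- a radius `r'` on which the axis is `J`-holomorphic
  set r' : ℝ := min r R₁ with hr'_def
  have hr' : 0 < r' := lt_min hr hR₁
  have hr'r : r' ≤ r := min_le_left _ _
  have hhol : ∀ ζ : ℂ, ‖ζ - z₁‖ < r' → ∀ α β : ℂ,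
      J ((sheetChart J b ν₀) (ζ, 0)) (fderiv ℝ (sheetChart J b ν₀) (ζ, 0) (α, β)) =
        fderiv ℝ (sheetChart J b ν₀) (ζ, 0) (Complex.I * α, Complex.I * β) := by
    intro ζ hζ α β
    have hζ₁ : ζ ∈ ball z₁ R₁ := by
      rw [mem_ball, dist_eq_norm]
      exact hζ.trans_le (min_le_right _ _)
    have hd : fderiv ℝ (sheetChart J b ν₀) (ζ, 0) = sheetChartDeriv J b ν₀ ζ :=
      (hasFDerivAt_sheetChart ((hb.differentiable (by simp)) ζ)
        (((hJ.clm_apply contDiff_const).differentiable (by simp)) _)).fderiv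
    rw [hd, sheetChart_mk_zero]
    exact sheetChartDeriv_hol (hbJ ζ hζ₁) (hJ2 ζ hζ₁) α β
  have hB' : ∀ p ∈ ball ((z₁, 0) : ℂ × ℂ) r', ∀ q : ℂ × ℂ,
      ‖q‖ ≤ B * ‖fderiv ℝ (sheetChart J b ν₀) p q‖ :=
    fun p hp q => hB p (ball_subset_ball hr'r hp) q
  -- a radius `ρ₁` about `z₂` on which `v` stays in the target and `e.symm ∘ v` in the small ball
  have hxt : v z₂ ∈ e.target := by
    rw [hx, ← sheetChart_mk_zero J b ν₀ z₁, ← hcoe]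
    exact e.map_source hsrc
  have hsx : e.symm (v z₂) = (z₁, 0) := by
    rw [hx, ← sheetChart_mk_zero J b ν₀ z₁, ← hcoe]
    exact e.left_inv hsrc
  have hcont : ContinuousAt (fun ζ => e.symm (v ζ)) z₂ :=
    (e.continuousAt_symm hxt).comp hv.continuous.continuousAt
  have hev : ∀ᶠ ζ in 𝓝 z₂, v ζ ∈ e.target ∧ e.symm (v ζ) ∈ ball ((z₁, 0) : ℂ × ℂ) r' := by
    filter_upwards [hv.continuous.continuousAt.preimage_mem_nhds (e.open_target.mem_nhds hxt),
      hcont.preimage_mem_nhds (isOpen_ball.mem_nhds (by rw [hsx]; exact mem_ball_self hr'))]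
      with ζ h1 h2
    exact ⟨h1, h2⟩
  obtain ⟨ρ₁', hρ₁', hρ₁'b⟩ := Metric.eventually_nhds_iff_ball.1 hev
  set ρ₁ : ℝ := min ρ₁' R₂ with hρ₁_def
  have hρ₁ : 0 < ρ₁ := lt_min hρ₁' hR₂
  have hρ₁b : ∀ ζ ∈ ball z₂ ρ₁, v ζ ∈ e.target ∧ e.symm (v ζ) ∈ ball ((z₁, 0) : ℂ × ℂ) r' :=
    fun ζ hζ => hρ₁'b ζ (ball_subset_ball (min_le_left _ _) hζ)
  -- the coordinates `(a, c) = e.symm ∘ v`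
  set a : ℂ → ℂ := fun ζ => (e.symm (v ζ)).1 with ha_def
  set c : ℂ → ℂ := fun ζ => (e.symm (v ζ)).2 with hc_def
  have hac : ∀ ζ, (a ζ, c ζ) = e.symm (v ζ) := fun ζ => rfl
  have hsv : ContDiffOn ℝ ∞ (fun ζ => e.symm (v ζ)) (ball z₂ ρ₁) :=
    hsymm.comp hv.contDiffOn fun ζ hζ => (hρ₁b ζ hζ).1
  have ha : ContDiffOn ℝ ∞ a (ball z₂ ρ₁) := contDiff_fst.comp_contDiffOn hsv
  have hc : ContDiffOn ℝ ∞ c (ball z₂ ρ₁) := contDiff_snd.comp_contDiffOn hsv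
  have hin : ∀ ζ ∈ ball z₂ ρ₁, (a ζ, c ζ) ∈ ball ((z₁, 0) : ℂ × ℂ) r' :=
    fun ζ hζ => (hρ₁b ζ hζ).2
  -- `(sheetChart J b ν₀) ∘ (a, c) = v` on the ball, hence `J`-holomorphic there
  have hEv : ∀ ζ ∈ ball z₂ ρ₁, (sheetChart J b ν₀) (a ζ, c ζ) = v ζ := fun ζ hζ => by
    rw [hac, ← hcoe]
    exact e.right_inv (hρ₁b ζ hζ).1
  have hJhol : ∀ ζ ∈ ball z₂ ρ₁, ∀ θ : ℂ,
      fderiv ℝ (fun ζ => (sheetChart J b ν₀) (a ζ, c ζ)) ζ (Complex.I * θ) =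
        J ((sheetChart J b ν₀) (a ζ, c ζ))
          (fderiv ℝ (fun ζ => (sheetChart J b ν₀) (a ζ, c ζ)) ζ θ) := by
    intro ζ hζ θ
    have heq : (fun ζ => (sheetChart J b ν₀) (a ζ, c ζ)) =ᶠ[𝓝 ζ] v := by
      filter_upwards [isOpen_ball.mem_nhds hζ] with ζ' hζ'
      exact hEv ζ' hζ'
    rw [heq.fderiv_eq, hEv ζ hζ]
    exact hvJ ζ (ball_subset_ball (min_le_right _ _) hζ) θ
  -- the scalar reduction: `‖∂̄ c‖ ≤ M ‖c‖` on a closed disc about `z₂`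
  obtain ⟨ρ, M, hρ, hρρ₁, -, hbound⟩ := sheetDbarInequality_local J hJ (sheetChart J b ν₀) hE z₁ r'
    B hr' hhol hB' a c z₂ ρ₁ hρ₁ ha hc hin hJhol
  -- the local similarity principle for `c` on `B(z₂, ρ)` with inequality on `B̄(z₂, ρ/2)`
  have hc' : ContDiffOn ℝ ∞ c (ball z₂ (2 * (ρ / 2))) := by
    rw [mul_div_cancel₀ ρ two_ne_zero]
    exact hc.mono (ball_subset_ball hρρ₁.le)
  have hbound' : ∀ ζ ∈ closedBall z₂ (ρ / 2), ‖dbarAlong 1 c ζ‖ ≤ M * ‖c ζ‖ :=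
    fun ζ hζ => hbound ζ (closedBall_subset_closedBall (by linarith) hζ)
  have h0 : c z₂ = 0 := by simp only [hc_def, hsx]
  have hdich := similarity_local_dichotomy c z₂ (ρ / 2) M (by linarith) hc' hbound' h0
  refine ⟨ν₀, e, ρ₁, hcoe, hsrc, hsymm, hρ₁, fun ζ hζ => (hρ₁b ζ hζ).1, ?_⟩
  rcases hdich with hzero | ⟨ε, hε, hερ, hne, hwind⟩
  · exact Or.inl hzero
  · exact Or.inr ⟨ε, hε, by linarith, hne, hwind⟩

end Literature.Geometry.Symplectic

end
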